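import Summits.QuantumFields.BalabanUV.Beta.D1BFx.TorusScalarCoarseGram
import Summits.QuantumFields.BalabanUV.Beta.D1BFx.GhostSplitJetsFree
import Summits.QuantumFields.BalabanUV.Beta.D1BFx.TorusGaugeBasisKernel

/-!
# `BalabanUV.Beta.D1BFx.TorusGhostSideZero` — road «BF-x», binder row D1, slot (K), X₃(ii) ROUTE T, brick **K-TB3c PART 2, FILE 3** «THE GHOST SIDE OF
# ROUTE T AT `U = 1`, END TO END»: on the fine torus `Site 4 s` (`s = (m+1)·p`, `a > 0`), for ANY basis `N` of the block-mean-free site functions with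
# K-TB3b-N's two conclusions (`∀ λ, Ŝλ = 0 ↔ ∃ c, λ = N c`; `N.mulVec` injective) and ANY three jets `Lₛ Lₜ Lₛₜ` (TB4-W) of the colour-stripped covariant
# Laplacian in the normalisation `Δ₀ = (m+1)²•L̂`:
# **`hessT (NᵀX₀N)⁻¹ (NᵀXₛN) (NᵀXₜN) (NᵀXₛₜN) = 2·hessT Ĝ′ Lₛ Lₜ Lₛₜ + hessT ((m+1)⁻⁴•Ĉsq) Sₛ Sₜ Sₛₜ`** — `X` the product-rule jets of `Δ_U²`, the legs
# `Ĝ′ = PeriodisedProjector.Ghat`, `Ĉsq = TorusScalarCoarseGram.CsqHat` PERIODISED `ℤ⁴` KERNELS, the S-jets explicit words in `Qind`, `Ĝ′Ĝ′` and the jets of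
# `ÂX²` — i.e. DECISION 2's «`h[NᵀΔ_U²N] = 2h[G′] + h[Csq]`» with every leg socket a tree fact and the DIMENSION COUNT derived by rank–nullity.

HONEST DEPENDENCY (cell records, verbatim): «continuum YM on T⁴ ⇐ BetaPertH ∧ nine spine estimates (0/9 proved); BetaPertH ⇐ (D1) ∧ (D4) ∧
CAP+tail; G-an2-4 gates asym, D1 and NE2/3/4.»  HONEST FRAMING (cell contract, verbatim): «discharging `BetaPertH` makes Bałaban's UV stability
UNCONDITIONAL — a real constructive-QFT result; it is NOT the continuum limit and NOT the Clay problem.»  THIS MODULE DISCHARGES NOTHING of (K),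
of D1 or of the wall: a [folklore] COMPOSITION BY NAME of this lineage's `GhostSplitJetsFree` (K-TB3a PART 3: `hessT_compressed_jets_free`,
`hessT_kkt_sq_jets_free`), `GhostCompressionJets.hessT_kkt_shift_sq_jets` (K-TB3a PART 2), FILES 1–2 (`Qind`, `Qind_mulVec_eq_zero_iff`,
`Qind_mul_Qind_transpose`, `det_Qind_mul_Qind_transpose_ne_zero`, `AXhat_eq_lap_add_border`, `det_compressed_lap_sq_ne_zero`, `det_AXhat_ne_zero`,
`inv_AXhat_mul_AXhat`, `det_S0_ne_zero`, `inv_S0`), the owner's `PeriodisedProjector.Ghat_mul_AXhat`, ne9-leaf-09-g38's K-TB3b-N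
`TorusGaugeBasisKernel` (`Nhat_range`, `Nhat_injective`), and Mathlib's rank–nullity
(`LinearMap.finrank_range_add_finrank_ker`, `finrank_range_of_inj`, `Matrix.exists_mulVec_eq_zero_iff`).  No definition, no `def … : Prop`, nothing cited,
0 sorry.  NOT D1, NOT BetaPertH, NOT continuum, NOT Clay.

ABSOLUTE RULE (cell charter, verbatim): «No internally-minted statement may enter as a cited fact. Every hypothesis is either kernel-proved in this
package or a verbatim quotation of a PUBLISHED theorem with page reference. The manuscript(s) under audit are NOT citable for their own disputed
steps — they are the thing under adjudication; programme-internal (2001/route/tribunal) claims are never citable.»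

WHERE THIS SITS (`HOME/b2b-balaban-beta-d1-p2/K-ASSEMBLY-SPEC-v2.md` v2.3 §0 DECISION 2, §2 rows K-TB3a∕K-TB3c, §4 TB5; OWNER RULING ρ-g6-12 (1):
«`Φ_i = W₀ᵀB_iW₀` … `T(U) = NᵀL_UD_U*`, `A(U) = 2•(NᵀL_UL_UN)⁻¹`, `L_U = D_U*D_U` … consistent with K-TB3a's ghost split (`L_U N = Δ′_a(U) N` on `ker Q′` ⟹
`det(NᵀL_U²N)` = the compression of `M₀(U)²` to `ker Q′`)»).  K-TA4G (R2) leaves the ghost term `hessT((NᵀL₀²N)⁻¹; jets of NᵀL_U²N)`; THIS FILE is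
that term AT `U = 1` as a sum of two `hessT`s whose LEGS are periodised `ℤ⁴` kernels (so TA3b's `p → ∞` sockets `TorusGhostLegs.tendsto_hessT_Ggh` ∕
`TorusGhostGram.tendsto_hessT_CsqK` apply once the JETS are exhibited as periodised arrays — TB4-W ∕ the dictionary of record; NOT here).
CONTENT (`m`, `a > 0`, `hs : s = (m+1)·p`, `[NeZero s] [NeZero p]`, `N : Matrix (Site 4 s) ρ ℝ`; all [folklore]):
* §1 THE BASIS FACTS ⟹ THE COMPRESSION DATA: `det_gram_ne_zero_of_injective` (`N` injective ⟹ `det (NᵀN) ≠ 0`), `Qind_mul_eq_zero_of_range`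
  (`range N = ker Ŝ` ⟹ `Qind·N = 0`), **`card_basis_add_card_coarse`** (`range N = ker Ŝ` ∧ `N` injective ⟹ `|ρ| + |Site 4 p| = |Site 4 s|`, rank–nullity for
  the onto map `Qind`).
* §2 **`hessT_ghost_side_zero`** — the END displayed above, letters `X₀ … Xₛₜ` (jets of `((m+1)²L̂)²`), `X₀′ … Xₛₜ′` (jets of `ÂX²`), `Sₛ Sₜ Sₛₜ` (explicit
  words) given as equations; proof = compression (`hessT_compressed_jets_free`) ∘ shift (`hessT_kkt_shift_sq_jets`, constant border
  `Qindᵀ((a/(m+1)⁴)•1)Qind`) ∘ split (`hessT_kkt_sq_jets_free`) ∘ leg letters (`ÂX⁻¹ = Ĝ′`, `(ÂX²)⁻¹ = Ĝ′Ĝ′`, `S₀⁻¹ = (m+1)⁻⁴•Ĉsq`).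
* §3 **`hessT_ghost_side_zero_Nhat`** — the END at the road's basis `N := TorusGaugeBasisMatrix.Nhat r (m+1) p` (`hr : r ∈ box 4 (m+1)`), with
  ne9-leaf-09-g38's K-TB3b-N `TorusGaugeBasisKernel.Nhat_range` ∕ `Nhat_injective` plugged in VERBATIM: the only inputs left are the three jets.
NOT HERE: the jets themselves (TB4-W), the `× Unit` ∕ sorted re-reading of the END (one `hessT_submatrix_equiv` each; TB5's call), the `p → ∞` limit,
anything at `U ≠ 1`, the colour weights.
Provenance: NE9 formalisation swarm leaf seat `b2b-balaban-t4-ne9-formalise-leaf-02` gen 26 (cross-row prover duty NE9 → β∕D1 road «BF-x»; journal CLAIM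
«K-TB3c PART 2» l.22923, INTENT FILE 3 l.23486), 2026-08-20.
-/

noncomputable section

namespace Summit.QuantumFields.BalabanUV.Beta.D1BFx.TorusGhostSideZero

open Matrix
open Literature.MathematicalPhysics.QuantumFieldTheory.Balaban1983to89
open Literature.MathematicalPhysics.QuantumFieldTheory.Balaban1983to89.Beta
open Literature.MathematicalPhysics.QuantumFieldTheory.Balaban1983to89.Beta.Composition (kkt)
open Summit.QuantumFields.BalabanUV.Beta.D1BFx.MixedVarPackedHess (hessT)
open Summit.QuantumFields.BalabanUV.Beta.D1BFx.PeriodisedProjector (Ghat AXhat Lhat Shat Ghat_mul_AXhat)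
open Summit.QuantumFields.BalabanUV.Beta.D1BFx.TorusScalarAveraging
open Summit.QuantumFields.BalabanUV.Beta.D1BFx.TorusScalarCoarseGram
open Summit.QuantumFields.BalabanUV.Beta.D1BFx.GhostCompressionJets (hessT_kkt_shift_sq_jets)
open Summit.QuantumFields.BalabanUV.Beta.D1BFx.GhostSplitJetsFree (hessT_compressed_jets_free hessT_kkt_sq_jets_free)
open AffineAveraging (box toSite)
open Summit.QuantumFields.BalabanUV.Beta.D1BFx.TorusCombKKT (CombRows)
open Summit.QuantumFields.BalabanUV.Beta.D1BFx.TorusGaugeBasisMatrix (Nhat)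
open Summit.QuantumFields.BalabanUV.Beta.D1BFx.TorusGaugeBasisKernel (Nhat_range Nhat_injective)

variable (m : ℕ) {a : ℝ} {s p : ℕ} [NeZero s] [NeZero p] {ρ : Type*} [Fintype ρ] [DecidableEq ρ]

/-! ## §1 The basis facts ⟹ the compression hypotheses -/

omit [NeZero p] in
/-- [folklore] An injective real matrix has a non-degenerate Gram matrix: `NᵀN v = 0 ⟹ ‖Nv‖² = 0 ⟹ v = 0`. -/
theorem det_gram_ne_zero_of_injective (N : Matrix (Site 4 s) ρ ℝ) (hinj : Function.Injective N.mulVec) : (Nᵀ * N).det ≠ 0 := by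
  classical
  intro h0
  obtain ⟨v, hv, hmul⟩ := Matrix.exists_mulVec_eq_zero_iff.2 h0
  have hsq : (N *ᵥ v) ⬝ᵥ (N *ᵥ v) = 0 := by
    have h1 : v ⬝ᵥ ((Nᵀ * N) *ᵥ v) = 0 := by rw [hmul, dotProduct_zero]
    rwa [← Matrix.mulVec_mulVec, Matrix.dotProduct_mulVec, Matrix.vecMul_transpose] at h1
  have hNv : N *ᵥ v = 0 := dotProduct_self_eq_zero.1 hsq
  exact hv (hinj (by rw [hNv, Matrix.mulVec_zero]))

omit [DecidableEq ρ] in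
/-- [folklore] **`range N = ker Ŝ` ⟹ `Qind·N = 0`** (every column of `N` is block-mean-free; `Qind·λ = 0 ↔ Ŝ·λ = 0`). -/
theorem Qind_mul_eq_zero_of_range (hs : s = (m + 1) * p) (N : Matrix (Site 4 s) ρ ℝ)
    (hrange : ∀ lam : Site 4 s → ℝ, Shat m s *ᵥ lam = 0 ↔ ∃ c : ρ → ℝ, lam = N *ᵥ c) : Qind m s p * N = 0 := by
  refine Matrix.ext_iff_mulVec.2 fun c => ?_
  rw [← Matrix.mulVec_mulVec, Matrix.zero_mulVec, Qind_mulVec_eq_zero_iff hs]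
  exact (hrange _).2 ⟨c, rfl⟩

omit [DecidableEq ρ] in
/-- [folklore] **THE DIMENSION COUNT `|ρ| + |Site 4 p| = |Site 4 s|`** from `range N = ker Ŝ` and `N` injective: rank–nullity for `Qind` (onto, since
`Qind·Qindᵀ = (m+1)⁴•1`; kernel `= ker Ŝ = range N ≅ ℝ^ρ`). -/
theorem card_basis_add_card_coarse (hs : s = (m + 1) * p) (N : Matrix (Site 4 s) ρ ℝ)
    (hrange : ∀ lam : Site 4 s → ℝ, Shat m s *ᵥ lam = 0 ↔ ∃ c : ρ → ℝ, lam = N *ᵥ c) (hinj : Function.Injective N.mulVec) :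
    Fintype.card ρ + Fintype.card (Site 4 p) = Fintype.card (Site 4 s) := by
  have hc : (((m : ℝ) + 1) ^ 4) ≠ 0 := by positivity
  -- `Qind` is onto
  have hsurj : Function.Surjective (Qind m s p).mulVecLin := by
    intro w
    refine ⟨(Qind m s p)ᵀ *ᵥ ((((m : ℝ) + 1) ^ 4)⁻¹ • w), ?_⟩
    rw [Matrix.mulVecLin_apply, Matrix.mulVec_mulVec, Qind_mul_Qind_transpose hs, Matrix.smul_mulVec, Matrix.one_mulVec, smul_smul,
      mul_inv_cancel₀ hc, one_smul]
  have hrangeQ : Module.finrank ℝ (LinearMap.range (Qind m s p).mulVecLin) = Fintype.card (Site 4 p) := by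
    rw [LinearMap.range_eq_top.2 hsurj, finrank_top, Module.finrank_fintype_fun_eq_card]
  -- `ker Qind = range N`
  have hker : LinearMap.ker (Qind m s p).mulVecLin = LinearMap.range N.mulVecLin := by
    ext lam
    rw [LinearMap.mem_ker, Matrix.mulVecLin_apply, Qind_mulVec_eq_zero_iff hs, hrange, LinearMap.mem_range]
    simp only [Matrix.mulVecLin_apply]
    exact ⟨fun ⟨c, hc⟩ => ⟨c, hc.symm⟩, fun ⟨c, hc⟩ => ⟨c, hc.symm⟩⟩
  have hkerQ : Module.finrank ℝ (LinearMap.ker (Qind m s p).mulVecLin) = Fintype.card ρ := by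
    rw [hker, LinearMap.finrank_range_of_inj (f := N.mulVecLin) hinj, Module.finrank_fintype_fun_eq_card]
  have h := LinearMap.finrank_range_add_finrank_ker (Qind m s p).mulVecLin
  rw [hrangeQ, hkerQ, Module.finrank_fintype_fun_eq_card] at h
  omega

/-! ## §2 THE GHOST SIDE OF ROUTE T AT `U = 1`, END TO END -/

/-- [folklore] **THE GHOST SIDE OF ROUTE T AT `U = 1`, END TO END.**  On the fine torus `Site 4 s`, `s = (m+1)·p`, `a > 0`, for ANY basis `N` of the
block-mean-free site functions (`range N = ker Ŝ`, `N` injective — K-TB3b-N's two conclusions) and ANY three jets `Lₛ Lₜ Lₛₜ` of the (scalar, colour-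
stripped) covariant Laplacian at `U = 1` in the normalisation `Δ₀ = (m+1)²•L̂` (TB4-W): the compressed one-loop functional of the Gram `Nᵀ Δ_U² N`
(DECISION 2 ∕ K-TA4G (R2)'s `τ′W = 2A⁻¹`) SPLITS as
`hessT (NᵀX₀N)⁻¹ (NᵀXₛN) (NᵀXₜN) (NᵀXₛₜN) = 2·hessT Ĝ′ Lₛ Lₜ Lₛₜ + hessT ((m+1)⁻⁴•Ĉsq) Sₛ Sₜ Sₛₜ`
with `X` = the product-rule jets of `Δ_U²`, the tower leg `Ĝ′ = PeriodisedProjector.Ghat` and the coarse leg `Ĉsq` PERIODISED `ℤ⁴` KERNELS, and the S-jets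
the explicit words `Sₛ = −Qind·Ĝ′Ĝ′·X′ₛ·Ĝ′Ĝ′·Qindᵀ`, … in the jets `X′` of `M_U² `, `M_U = Δ_U + Qindᵀ((a/(m+1)⁴)•1)Qind` (`M₀ = ÂX`).
CHAIN (all BY NAME): `GhostSplitJetsFree.hessT_compressed_jets_free` (sockets `card_basis_add_card_coarse`, `Qind_mul_eq_zero_of_range`,
`det_Qind_mul_Qind_transpose_ne_zero`, `det_gram_ne_zero_of_injective`, `det_compressed_lap_sq_ne_zero`) → `GhostCompressionJets.hessT_kkt_shift_sq_jets`
(`AXhat_eq_lap_add_border`, constant `a`) → `GhostSplitJetsFree.hessT_kkt_sq_jets_free` (`det_AXhat_ne_zero`, `det_S0_ne_zero`) → the leg letters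
`inv ÂX = Ĝ′` (`Ghat_mul_AXhat`), `inv_AXhat_mul_AXhat`, `inv_S0`.  Every leg socket is a tree fact; the inputs left are `N` (K-TB3b-N) and the jets (TB4-W). -/
theorem hessT_ghost_side_zero (ha : 0 < a) (hs : s = (m + 1) * p) (N : Matrix (Site 4 s) ρ ℝ)
    (hrange : ∀ lam : Site 4 s → ℝ, Shat m s *ᵥ lam = 0 ↔ ∃ c : ρ → ℝ, lam = N *ᵥ c) (hinj : Function.Injective N.mulVec)
    (Lₛ Lₜ Lₛₜ X₀ Xₛ Xₜ Xₛₜ X₀' Xₛ' Xₜ' Xₛₜ' : Matrix (Site 4 s) (Site 4 s) ℝ) (Sₛ Sₜ Sₛₜ : Matrix (Site 4 p) (Site 4 p) ℝ)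
    (hX₀ : X₀ = ((((m : ℝ) + 1) ^ 2) • Lhat s) * ((((m : ℝ) + 1) ^ 2) • Lhat s))
    (hXₛ : Xₛ = Lₛ * ((((m : ℝ) + 1) ^ 2) • Lhat s) + ((((m : ℝ) + 1) ^ 2) • Lhat s) * Lₛ)
    (hXₜ : Xₜ = Lₜ * ((((m : ℝ) + 1) ^ 2) • Lhat s) + ((((m : ℝ) + 1) ^ 2) • Lhat s) * Lₜ)
    (hXₛₜ : Xₛₜ = Lₛₜ * ((((m : ℝ) + 1) ^ 2) • Lhat s) + Lₛ * Lₜ + Lₜ * Lₛ + ((((m : ℝ) + 1) ^ 2) • Lhat s) * Lₛₜ)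
    (hX₀' : X₀' = AXhat m a s * AXhat m a s) (hXₛ' : Xₛ' = Lₛ * AXhat m a s + AXhat m a s * Lₛ) (hXₜ' : Xₜ' = Lₜ * AXhat m a s + AXhat m a s * Lₜ)
    (hXₛₜ' : Xₛₜ' = Lₛₜ * AXhat m a s + Lₛ * Lₜ + Lₜ * Lₛ + AXhat m a s * Lₛₜ)
    (hSₛ : Sₛ = -(Qind m s p * (Ghat m a s * Ghat m a s) * Xₛ' * (Ghat m a s * Ghat m a s) * (Qind m s p)ᵀ))
    (hSₜ : Sₜ = -(Qind m s p * (Ghat m a s * Ghat m a s) * Xₜ' * (Ghat m a s * Ghat m a s) * (Qind m s p)ᵀ))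
    (hSₛₜ : Sₛₜ = Qind m s p * (Ghat m a s * Ghat m a s) * Xₛ' * (Ghat m a s * Ghat m a s) * Xₜ' * (Ghat m a s * Ghat m a s) * (Qind m s p)ᵀ
        + Qind m s p * (Ghat m a s * Ghat m a s) * Xₜ' * (Ghat m a s * Ghat m a s) * Xₛ' * (Ghat m a s * Ghat m a s) * (Qind m s p)ᵀ
        - Qind m s p * (Ghat m a s * Ghat m a s) * Xₛₜ' * (Ghat m a s * Ghat m a s) * (Qind m s p)ᵀ) :
    hessT (Nᵀ * X₀ * N)⁻¹ (Nᵀ * Xₛ * N) (Nᵀ * Xₜ * N) (Nᵀ * Xₛₜ * N)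
      = 2 * hessT (Ghat m a s) Lₛ Lₜ Lₛₜ + hessT ((((m : ℝ) + 1) ^ 4)⁻¹ • CsqHat m a p) Sₛ Sₜ Sₛₜ := by
  have hQN : Qind m s p * N = 0 := Qind_mul_eq_zero_of_range m hs N hrange
  have hN : (Nᵀ * N).det ≠ 0 := det_gram_ne_zero_of_injective N hinj
  have hcard : Fintype.card ρ + Fintype.card (Site 4 p) = Fintype.card (Site 4 s) := card_basis_add_card_coarse m hs N hrange hinj
  have hQ : (Qind m s p * (Qind m s p)ᵀ).det ≠ 0 := det_Qind_mul_Qind_transpose_ne_zero (m := m) hs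
  have hd : (Nᵀ * X₀ * N).det ≠ 0 := by rw [hX₀]; exact det_compressed_lap_sq_ne_zero m ha hs N hQN hN
  -- (1) compression
  have step1 := hessT_compressed_jets_free hcard X₀ Xₛ Xₜ Xₛₜ (Qind m s p) N hQN hQ hN hd
  -- (2) shift by the constant border `Qindᵀ((a/(m+1)⁴)•1)Qind`
  have h0 : ∀ L : Matrix (Site 4 s) (Site 4 s) ℝ, L = L + (Qind m s p)ᵀ * ((0 : Matrix (Site 4 p) (Site 4 p) ℝ) * Qind m s p) := fun L => by
    rw [Matrix.zero_mul, Matrix.mul_zero, add_zero]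
  have hM₀ : AXhat m a s = (((m : ℝ) + 1) ^ 2) • Lhat s
      + (Qind m s p)ᵀ * (((a / ((m : ℝ) + 1) ^ 4) • (1 : Matrix (Site 4 p) (Site 4 p) ℝ)) * Qind m s p) := by
    rw [AXhat_eq_lap_add_border (m := m) a hs, Matrix.mul_assoc]
  have step2 := hessT_kkt_shift_sq_jets ((((m : ℝ) + 1) ^ 2) • Lhat s) Lₛ Lₜ Lₛₜ (AXhat m a s) Lₛ Lₜ Lₛₜ X₀ Xₛ Xₜ Xₛₜ X₀' Xₛ' Xₜ' Xₛₜ'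
    (Qind m s p) ((a / ((m : ℝ) + 1) ^ 4) • (1 : Matrix (Site 4 p) (Site 4 p) ℝ)) 0 0 0 hM₀
    (h0 Lₛ) (h0 Lₜ) (h0 Lₛₜ) hX₀ hXₛ hXₜ hXₛₜ hX₀' hXₛ' hXₜ' hXₛₜ' step1.2
  -- (3) the split, with the inverses read as the periodised legs
  have hG : (AXhat m a s * AXhat m a s)⁻¹ = Ghat m a s * Ghat m a s := inv_AXhat_mul_AXhat m ha hs
  have hS0 : (Qind m s p * X₀'⁻¹ * (Qind m s p)ᵀ).det ≠ 0 := by rw [hX₀']; exact det_S0_ne_zero m ha hs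
  have step3 : hessT (kkt X₀' (Qind m s p))⁻¹ (kkt Xₛ' (0 : Matrix (Site 4 p) (Site 4 s) ℝ)) (kkt Xₜ' (0 : Matrix (Site 4 p) (Site 4 s) ℝ))
      (kkt Xₛₜ' (0 : Matrix (Site 4 p) (Site 4 s) ℝ))
      = 2 * hessT (AXhat m a s)⁻¹ Lₛ Lₜ Lₛₜ + hessT (Qind m s p * X₀'⁻¹ * (Qind m s p)ᵀ)⁻¹ Sₛ Sₜ Sₛₜ := by
    refine hessT_kkt_sq_jets_free (AXhat m a s) Lₛ Lₜ Lₛₜ X₀' Xₛ' Xₜ' Xₛₜ' (Qind m s p) 0 0 0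
      (Qind m s p * X₀'⁻¹ * (Qind m s p)ᵀ) Sₛ Sₜ Sₛₜ hX₀' hXₛ' hXₜ' hXₛₜ' rfl ?_ ?_ ?_ (det_AXhat_ne_zero m ha hs).1 hS0
    · rw [hSₛ, hX₀', hG]; simp only [Matrix.zero_mul, Matrix.transpose_zero, Matrix.mul_zero, zero_add, zero_sub]
    · rw [hSₜ, hX₀', hG]; simp only [Matrix.zero_mul, Matrix.transpose_zero, Matrix.mul_zero, zero_add, zero_sub]
    · rw [hSₛₜ, hX₀', hG]; simp only [Matrix.zero_mul, Matrix.transpose_zero, Matrix.mul_zero, zero_add, add_zero, sub_zero]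
  rw [step1.1, step2, step3, Matrix.inv_eq_right_inv (Ghat_mul_AXhat (m := m) (a := a) (s := s) ha hs).2, hX₀', inv_S0 m ha hs]

/-! ## §3 The END at the road's basis `N := N̂` (K-TB3b-N) -/

/-- [folklore] **THE GHOST SIDE AT `U = 1` ON THE ROAD'S BASIS `N̂`** (`TorusGaugeBasisMatrix.Nhat r (m+1) p`, centre `r ∈ box 4 (m+1)`): the END of §2 with
`hrange := TorusGaugeBasisKernel.Nhat_range`, `hinj := Nhat_injective` — the only inputs left are the three Laplacian jets (TB4-W). -/
theorem hessT_ghost_side_zero_Nhat {r : Fin (3 + 1) → ℕ} (ha : 0 < a) (hr : r ∈ box (3 + 1) (m + 1))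
    (Lₛ Lₜ Lₛₜ X₀ Xₛ Xₜ Xₛₜ X₀' Xₛ' Xₜ' Xₛₜ' : Matrix (Site 4 ((m + 1) * p)) (Site 4 ((m + 1) * p)) ℝ) (Sₛ Sₜ Sₛₜ : Matrix (Site 4 p) (Site 4 p) ℝ)
    (hX₀ : X₀ = ((((m : ℝ) + 1) ^ 2) • Lhat ((m + 1) * p)) * ((((m : ℝ) + 1) ^ 2) • Lhat ((m + 1) * p)))
    (hXₛ : Xₛ = Lₛ * ((((m : ℝ) + 1) ^ 2) • Lhat ((m + 1) * p)) + ((((m : ℝ) + 1) ^ 2) • Lhat ((m + 1) * p)) * Lₛ)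
    (hXₜ : Xₜ = Lₜ * ((((m : ℝ) + 1) ^ 2) • Lhat ((m + 1) * p)) + ((((m : ℝ) + 1) ^ 2) • Lhat ((m + 1) * p)) * Lₜ)
    (hXₛₜ : Xₛₜ = Lₛₜ * ((((m : ℝ) + 1) ^ 2) • Lhat ((m + 1) * p)) + Lₛ * Lₜ + Lₜ * Lₛ + ((((m : ℝ) + 1) ^ 2) • Lhat ((m + 1) * p)) * Lₛₜ)
    (hX₀' : X₀' = AXhat m a ((m + 1) * p) * AXhat m a ((m + 1) * p))
    (hXₛ' : Xₛ' = Lₛ * AXhat m a ((m + 1) * p) + AXhat m a ((m + 1) * p) * Lₛ)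
    (hXₜ' : Xₜ' = Lₜ * AXhat m a ((m + 1) * p) + AXhat m a ((m + 1) * p) * Lₜ)
    (hXₛₜ' : Xₛₜ' = Lₛₜ * AXhat m a ((m + 1) * p) + Lₛ * Lₜ + Lₜ * Lₛ + AXhat m a ((m + 1) * p) * Lₛₜ)
    (hSₛ : Sₛ = -(Qind m ((m + 1) * p) p * (Ghat m a ((m + 1) * p) * Ghat m a ((m + 1) * p)) * Xₛ'
        * (Ghat m a ((m + 1) * p) * Ghat m a ((m + 1) * p)) * (Qind m ((m + 1) * p) p)ᵀ))
    (hSₜ : Sₜ = -(Qind m ((m + 1) * p) p * (Ghat m a ((m + 1) * p) * Ghat m a ((m + 1) * p)) * Xₜ'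
        * (Ghat m a ((m + 1) * p) * Ghat m a ((m + 1) * p)) * (Qind m ((m + 1) * p) p)ᵀ))
    (hSₛₜ : Sₛₜ = Qind m ((m + 1) * p) p * (Ghat m a ((m + 1) * p) * Ghat m a ((m + 1) * p)) * Xₛ'
          * (Ghat m a ((m + 1) * p) * Ghat m a ((m + 1) * p)) * Xₜ' * (Ghat m a ((m + 1) * p) * Ghat m a ((m + 1) * p)) * (Qind m ((m + 1) * p) p)ᵀ
        + Qind m ((m + 1) * p) p * (Ghat m a ((m + 1) * p) * Ghat m a ((m + 1) * p)) * Xₜ'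
          * (Ghat m a ((m + 1) * p) * Ghat m a ((m + 1) * p)) * Xₛ' * (Ghat m a ((m + 1) * p) * Ghat m a ((m + 1) * p)) * (Qind m ((m + 1) * p) p)ᵀ
        - Qind m ((m + 1) * p) p * (Ghat m a ((m + 1) * p) * Ghat m a ((m + 1) * p)) * Xₛₜ'
          * (Ghat m a ((m + 1) * p) * Ghat m a ((m + 1) * p)) * (Qind m ((m + 1) * p) p)ᵀ) :
    hessT ((Nhat r (m + 1) p)ᵀ * X₀ * Nhat r (m + 1) p)⁻¹ ((Nhat r (m + 1) p)ᵀ * Xₛ * Nhat r (m + 1) p)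
        ((Nhat r (m + 1) p)ᵀ * Xₜ * Nhat r (m + 1) p) ((Nhat r (m + 1) p)ᵀ * Xₛₜ * Nhat r (m + 1) p)
      = 2 * hessT (Ghat m a ((m + 1) * p)) Lₛ Lₜ Lₛₜ + hessT ((((m : ℝ) + 1) ^ 4)⁻¹ • CsqHat m a p) Sₛ Sₜ Sₛₜ :=
  hessT_ghost_side_zero m ha rfl (Nhat r (m + 1) p) (Nhat_range r m p hr) (Nhat_injective r (m + 1) p hr)
    Lₛ Lₜ Lₛₜ X₀ Xₛ Xₜ Xₛₜ X₀' Xₛ' Xₜ' Xₛₜ' Sₛ Sₜ Sₛₜ hX₀ hXₛ hXₜ hXₛₜ hX₀' hXₛ' hXₜ' hXₛₜ' hSₛ hSₜ hSₛₜ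

end Summit.QuantumFields.BalabanUV.Beta.D1BFx.TorusGhostSideZero

end
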